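import Summits.MatrixMultiplication.OmegaCensus.C2Quaternion16ShapeD
import Summits.MatrixMultiplication.OmegaCensus.C2Quaternion16ShapeF
import Summits.MatrixMultiplication.OmegaCensus.C2QuaternionLawModSixFourAll
import Summits.MatrixMultiplication.OmegaCensus.C2Quaternion40Law
import HarnessLib

/-!
# `β(C₂ × Q₁₆) = 32` (kernel)

ω-census, family (b3).  Framing: lottery ticket; floor = certified bounds/negative ranges.

`C₂ × Q₁₆ = G(ℤ₂ × ℤ₈, (0,4))`: the window `[32, 38]` (`c2_quaternion_window_mod_six_four`, `m = 4`) closes to `32`,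
so far an LRAT-checked census datum only.  The arithmetic at `N = 16` (`shape36_of_vertex_bounds`, `decide`) leaves only
`V = 36` with four shape types; two-domino shapes saturate (`quot_cyclic_of_two_two_sub_four`, `A/⟨c₀⟩ = ℤ₂ × ℤ₄` not
cyclic), P3 is `no_sub_four_P3_of_c0_ne_zero`, and the two sporadic shapes are `no_36_shape_d`, `no_36_shape_f`.
With `c2_quaternion_law_all`, `c2_quaternion_40_law`, `c2_quaternion_law`, `c2_quaternion_law_mod_six_one` the value
`β(C₂ × Q_{4m})` is now a kernel theorem for EVERY `m ≥ 3`.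
-/

namespace Summit.MatrixMultiplication.OmegaCensus

open Literature.Combinatorics.Additive Finset

set_option synthInstance.maxHeartbeats 400000 in
set_option synthInstance.maxSize 8192 in
/-- Finite check at `N = 16`: a volume in `[33, 38]` compatible with the eight vertex constraints is `36`, with one of
four shape types (two dominoes; P3; `(1,1|1,2|2,4)`; `(1,2|1,2|2,2)`; all up to roles/orientation). [folklore] -/
theorem vertex_fc36 :
    ((List.range 38).all fun S' =>
      (List.range (38 / (S' + 1))).all fun T' =>
      (List.range (38 / ((S' + 1) * (T' + 1)) - 32 / ((S' + 1) * (T' + 1)))).all fun U'' =>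
      (List.range (S' + 2)).all fun s₀ => (List.range (T' + 2)).all fun t₀ =>
      (List.range (U'' + 32 / ((S' + 1) * (T' + 1)) + 2)).all fun u₀ =>
        decide (
          let s₁ := S' + 1 - s₀
          let t₁ := T' + 1 - t₀
          let u₁ := U'' + 32 / ((S' + 1) * (T' + 1)) + 1 - u₀
          s₁ * t₀ * u₀ + s₀ * t₁ * u₀ + s₀ * t₀ * u₁ ≤ 16 → s₀ * t₁ * u₁ + s₁ * t₀ * u₁ + s₁ * t₁ * u₀ ≤ 16 →
          s₀ * t₀ * u₀ + s₁ * t₁ * u₀ + s₁ * t₀ * u₁ ≤ 16 → s₁ * t₁ * u₁ + s₀ * t₀ * u₁ + s₀ * t₁ * u₀ ≤ 16 →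
          s₁ * t₁ * u₀ + s₀ * t₀ * u₀ + s₀ * t₁ * u₁ ≤ 16 → s₀ * t₀ * u₁ + s₁ * t₁ * u₁ + s₁ * t₀ * u₀ ≤ 16 →
          s₁ * t₀ * u₁ + s₀ * t₁ * u₁ + s₀ * t₀ * u₀ ≤ 16 → s₀ * t₁ * u₀ + s₁ * t₀ * u₀ + s₁ * t₁ * u₁ ≤ 16 →
          (s₀ + s₁) * (t₀ + t₁) * (u₀ + u₁) = 36 ∧
          ((s₀ = 1 ∧ s₁ = 1 ∧ t₀ = 1 ∧ t₁ = 1) ∨ (s₀ = 1 ∧ s₁ = 1 ∧ u₀ = 1 ∧ u₁ = 1) ∨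
            (t₀ = 1 ∧ t₁ = 1 ∧ u₀ = 1 ∧ u₁ = 1) ∨
           (t₀ = t₁ ∧ u₀ = u₁ ∧ t₀ * u₀ = 3 ∧ (s₀ = s₁ + 1 ∨ s₁ = s₀ + 1)) ∨
           (s₀ = s₁ ∧ u₀ = u₁ ∧ s₀ * u₀ = 3 ∧ (t₀ = t₁ + 1 ∨ t₁ = t₀ + 1)) ∨
           (s₀ = s₁ ∧ t₀ = t₁ ∧ s₀ * t₀ = 3 ∧ (u₀ = u₁ + 1 ∨ u₁ = u₀ + 1)) ∨
           (s₀ = 1 ∧ s₁ = 1 ∧ t₀ + t₁ = 3 ∧ t₀ * t₁ = 2 ∧ u₀ + u₁ = 6 ∧ u₀ * u₁ = 8) ∨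
           (s₀ = 1 ∧ s₁ = 1 ∧ u₀ + u₁ = 3 ∧ u₀ * u₁ = 2 ∧ t₀ + t₁ = 6 ∧ t₀ * t₁ = 8) ∨
           (t₀ = 1 ∧ t₁ = 1 ∧ s₀ + s₁ = 3 ∧ s₀ * s₁ = 2 ∧ u₀ + u₁ = 6 ∧ u₀ * u₁ = 8) ∨
           (t₀ = 1 ∧ t₁ = 1 ∧ u₀ + u₁ = 3 ∧ u₀ * u₁ = 2 ∧ s₀ + s₁ = 6 ∧ s₀ * s₁ = 8) ∨
           (u₀ = 1 ∧ u₁ = 1 ∧ s₀ + s₁ = 3 ∧ s₀ * s₁ = 2 ∧ t₀ + t₁ = 6 ∧ t₀ * t₁ = 8) ∨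
           (u₀ = 1 ∧ u₁ = 1 ∧ t₀ + t₁ = 3 ∧ t₀ * t₁ = 2 ∧ s₀ + s₁ = 6 ∧ s₀ * s₁ = 8) ∨
           (u₀ = 2 ∧ u₁ = 2 ∧ s₀ + s₁ = 3 ∧ s₀ * s₁ = 2 ∧ t₀ + t₁ = 3 ∧ t₀ * t₁ = 2) ∨
           (t₀ = 2 ∧ t₁ = 2 ∧ s₀ + s₁ = 3 ∧ s₀ * s₁ = 2 ∧ u₀ + u₁ = 3 ∧ u₀ * u₁ = 2) ∨
           (s₀ = 2 ∧ s₁ = 2 ∧ t₀ + t₁ = 3 ∧ t₀ * t₁ = 2 ∧ u₀ + u₁ = 3 ∧ u₀ * u₁ = 2)))) = true := by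
  decide

/-- The arithmetic at `N = 16`: a volume in `[33, 38]` is `36` with one of the four shape types. [folklore] -/
theorem shape36_of_vertex_bounds (s₀ s₁ t₀ t₁ u₀ u₁ : ℕ)
    (h000 : s₁ * t₀ * u₀ + s₀ * t₁ * u₀ + s₀ * t₀ * u₁ ≤ 16) (h111 : s₀ * t₁ * u₁ + s₁ * t₀ * u₁ + s₁ * t₁ * u₀ ≤ 16)
    (h100 : s₀ * t₀ * u₀ + s₁ * t₁ * u₀ + s₁ * t₀ * u₁ ≤ 16) (h011 : s₁ * t₁ * u₁ + s₀ * t₀ * u₁ + s₀ * t₁ * u₀ ≤ 16)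
    (h010 : s₁ * t₁ * u₀ + s₀ * t₀ * u₀ + s₀ * t₁ * u₁ ≤ 16) (h101 : s₀ * t₀ * u₁ + s₁ * t₁ * u₁ + s₁ * t₀ * u₀ ≤ 16)
    (h001 : s₁ * t₀ * u₁ + s₀ * t₁ * u₁ + s₀ * t₀ * u₀ ≤ 16) (h110 : s₀ * t₁ * u₀ + s₁ * t₀ * u₀ + s₁ * t₁ * u₁ ≤ 16)
    (hlo : 33 ≤ (s₀ + s₁) * (t₀ + t₁) * (u₀ + u₁)) (hhi : (s₀ + s₁) * (t₀ + t₁) * (u₀ + u₁) ≤ 38) :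
    (s₀ + s₁) * (t₀ + t₁) * (u₀ + u₁) = 36 ∧
    ((s₀ = 1 ∧ s₁ = 1 ∧ t₀ = 1 ∧ t₁ = 1) ∨ (s₀ = 1 ∧ s₁ = 1 ∧ u₀ = 1 ∧ u₁ = 1) ∨
      (t₀ = 1 ∧ t₁ = 1 ∧ u₀ = 1 ∧ u₁ = 1) ∨
     (t₀ = t₁ ∧ u₀ = u₁ ∧ t₀ * u₀ = 3 ∧ (s₀ = s₁ + 1 ∨ s₁ = s₀ + 1)) ∨
     (s₀ = s₁ ∧ u₀ = u₁ ∧ s₀ * u₀ = 3 ∧ (t₀ = t₁ + 1 ∨ t₁ = t₀ + 1)) ∨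
     (s₀ = s₁ ∧ t₀ = t₁ ∧ s₀ * t₀ = 3 ∧ (u₀ = u₁ + 1 ∨ u₁ = u₀ + 1)) ∨
     (s₀ = 1 ∧ s₁ = 1 ∧ t₀ + t₁ = 3 ∧ t₀ * t₁ = 2 ∧ u₀ + u₁ = 6 ∧ u₀ * u₁ = 8) ∨
     (s₀ = 1 ∧ s₁ = 1 ∧ u₀ + u₁ = 3 ∧ u₀ * u₁ = 2 ∧ t₀ + t₁ = 6 ∧ t₀ * t₁ = 8) ∨
     (t₀ = 1 ∧ t₁ = 1 ∧ s₀ + s₁ = 3 ∧ s₀ * s₁ = 2 ∧ u₀ + u₁ = 6 ∧ u₀ * u₁ = 8) ∨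
     (t₀ = 1 ∧ t₁ = 1 ∧ u₀ + u₁ = 3 ∧ u₀ * u₁ = 2 ∧ s₀ + s₁ = 6 ∧ s₀ * s₁ = 8) ∨
     (u₀ = 1 ∧ u₁ = 1 ∧ s₀ + s₁ = 3 ∧ s₀ * s₁ = 2 ∧ t₀ + t₁ = 6 ∧ t₀ * t₁ = 8) ∨
     (u₀ = 1 ∧ u₁ = 1 ∧ t₀ + t₁ = 3 ∧ t₀ * t₁ = 2 ∧ s₀ + s₁ = 6 ∧ s₀ * s₁ = 8) ∨
     (u₀ = 2 ∧ u₁ = 2 ∧ s₀ + s₁ = 3 ∧ s₀ * s₁ = 2 ∧ t₀ + t₁ = 3 ∧ t₀ * t₁ = 2) ∨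
     (t₀ = 2 ∧ t₁ = 2 ∧ s₀ + s₁ = 3 ∧ s₀ * s₁ = 2 ∧ u₀ + u₁ = 3 ∧ u₀ * u₁ = 2) ∨
     (s₀ = 2 ∧ s₁ = 2 ∧ t₀ + t₁ = 3 ∧ t₀ * t₁ = 2 ∧ u₀ + u₁ = 3 ∧ u₀ * u₁ = 2)) := by
  set S := s₀ + s₁ with hS
  set T := t₀ + t₁ with hT
  set U := u₀ + u₁ with hU
  have hS1 : 1 ≤ S := Nat.pos_of_ne_zero (by rintro h0; rw [h0, zero_mul, zero_mul] at hlo; omega)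
  have hT1 : 1 ≤ T := Nat.pos_of_ne_zero (by rintro h0; rw [h0, mul_zero, zero_mul] at hlo; omega)
  have hU1 : 1 ≤ U := Nat.pos_of_ne_zero (by rintro h0; rw [h0, mul_zero] at hlo; omega)
  have hST : S * T ≤ 38 := le_trans (Nat.le_mul_of_pos_right _ hU1) hhi
  have hSle : S ≤ 38 := le_trans (Nat.le_mul_of_pos_right _ hT1) hST
  have iS : S - 1 < 38 := by omega
  have iT : T - 1 < 38 / (S - 1 + 1) := by
    rw [Nat.sub_add_cancel hS1]
    have : T ≤ 38 / S := (Nat.le_div_iff_mul_le hS1).2 (by rw [mul_comm]; exact hST)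
    omega
  have hq2 : U ≤ 38 / (S * T) := (Nat.le_div_iff_mul_le (by positivity)).2 (by rw [mul_comm]; exact hhi)
  have hq1 : 32 / (S * T) < U := (Nat.div_lt_iff_lt_mul (by positivity)).2 (by rw [mul_comm]; omega)
  have iU : U - (32 / ((S - 1 + 1) * (T - 1 + 1)) + 1) <
      38 / ((S - 1 + 1) * (T - 1 + 1)) - 32 / ((S - 1 + 1) * (T - 1 + 1)) := by
    rw [Nat.sub_add_cancel hS1, Nat.sub_add_cancel hT1]; omega
  have is₀ : s₀ < S - 1 + 2 := by omega
  have it₀ : t₀ < T - 1 + 2 := by omega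
  have iu₀ : u₀ < U - (32 / ((S - 1 + 1) * (T - 1 + 1)) + 1) + 32 / ((S - 1 + 1) * (T - 1 + 1)) + 2 := by
    rw [Nat.sub_add_cancel hS1, Nat.sub_add_cancel hT1]; omega
  have key := vertex_fc36
  simp only [List.all_eq_true, List.mem_range, decide_eq_true_iff] at key
  have k := key (S - 1) iS (T - 1) iT (U - (32 / ((S - 1 + 1) * (T - 1 + 1)) + 1)) iU s₀ is₀ t₀ it₀ u₀ iu₀
  have e1 : S - 1 + 1 - s₀ = s₁ := by omega
  have e2 : T - 1 + 1 - t₀ = t₁ := by omega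
  have e3 : U - (32 / ((S - 1 + 1) * (T - 1 + 1)) + 1) + 32 / ((S - 1 + 1) * (T - 1 + 1)) + 1 - u₀ = u₁ := by
    rw [Nat.sub_add_cancel hS1, Nat.sub_add_cancel hT1]; omega
  simp only [e1, e2, e3] at k
  exact k h000 h111 h100 h011 h010 h101 h001 h110

section Law

variable {G : Type} [Group G] [DecidableEq G] {ρ τ : ZMod 2 × ZMod 8 → G} {S T U : Finset G}

/-- **Volume `36` is impossible in `G(ℤ₂ × ℤ₈, (0,4))`**: the four shape types of `shape36_of_vertex_bounds` are
excluded by saturation (two dominoes), the P3 theorem, `no_36_shape_d` and `no_36_shape_f`. [folklore] -/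
theorem no_36_of_c2q16
    (hρρ : ∀ a b, ρ a * ρ b = ρ (a + b)) (hρτ : ∀ a b, ρ a * τ b = τ (b - a))
    (hτρ : ∀ a b, τ a * ρ b = τ (a + b))
    (hττ : ∀ a b, τ a * τ b = ρ (((0 : ZMod 2), (4 : ZMod 8)) + b - a))
    (hρ : Function.Injective ρ) (hτ : Function.Injective τ) (hne : ∀ a b, ρ a ≠ τ b)
    (hsurj : ∀ g, (∃ a, ρ a = g) ∨ (∃ a, τ a = g))
    (hnq : ¬ ∃ g : ZMod 2 × ZMod 8, ∀ x, x ∈ AddSubgroup.zmultiples g ∨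
      x + ((0 : ZMod 2), (4 : ZMod 8)) ∈ AddSubgroup.zmultiples g)
    (h : TripleProductProperty S T U) (hV : S.card * T.card * U.card = 36) : False := by
  have hc₀ : (((0 : ZMod 2), (4 : ZMod 8)) : ZMod 2 × ZMod 8) ≠ 0 := by decide
  have hA : Fintype.card (ZMod 2 × ZMod 8) = 16 := by rw [Fintype.card_prod, ZMod.card, ZMod.card]
  have er : (Equiv.mulRight (1 : G)).toEmbedding = Function.Embedding.refl G := by ext x; simp
  obtain ⟨h000, h111, h100, h011, h010, h101, h001, h110⟩ := vertex_counting' hρρ hρτ hτρ hττ hρ hτ hne h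
  rw [hA] at h000 h111 h100 h011 h010 h101 h001 h110
  have cS := card_eq_parts' hρ hτ hne hsurj S
  have cT := card_eq_parts' hρ hτ hne hsurj T
  have cU := card_eq_parts' hρ hτ hne hsurj U
  set s₀ := (univ.filter fun a : ZMod 2 × ZMod 8 => ρ a ∈ S).card with hs₀
  set s₁ := (univ.filter fun a : ZMod 2 × ZMod 8 => τ a ∈ S).card with hs₁
  set t₀ := (univ.filter fun a : ZMod 2 × ZMod 8 => ρ a ∈ T).card with ht₀
  set t₁ := (univ.filter fun a : ZMod 2 × ZMod 8 => τ a ∈ T).card with ht₁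
  set u₀ := (univ.filter fun a : ZMod 2 × ZMod 8 => ρ a ∈ U).card with hu₀
  set u₁ := (univ.filter fun a : ZMod 2 × ZMod 8 => τ a ∈ U).card with hu₁
  have hV' : (s₀ + s₁) * (t₀ + t₁) * (u₀ + u₁) = 36 := by rw [← cS, ← cT, ← cU]; exact hV
  obtain ⟨-, hsh⟩ := shape36_of_vertex_bounds s₀ s₁ t₀ t₁ u₀ u₁ h000 h111 h100 h011 h010 h101 h001 h110
    (by omega) (by omega)
  -- the volume identities
  have h20 : 3 * (S.card * T.card * U.card) + 20 = 8 * Fintype.card (ZMod 2 × ZMod 8) := by rw [hV, hA]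
  have h20_SUT : 3 * (S.card * U.card * T.card) + 20 = 8 * Fintype.card (ZMod 2 × ZMod 8) := by
    rw [show S.card * U.card * T.card = S.card * T.card * U.card by ring]; exact h20
  have h20_TSU : 3 * (T.card * S.card * U.card) + 20 = 8 * Fintype.card (ZMod 2 × ZMod 8) := by
    rw [show T.card * S.card * U.card = S.card * T.card * U.card by ring]; exact h20
  have h20_TUS : 3 * (T.card * U.card * S.card) + 20 = 8 * Fintype.card (ZMod 2 × ZMod 8) := by
    rw [show T.card * U.card * S.card = S.card * T.card * U.card by ring]; exact h20
  have h20_UST : 3 * (U.card * S.card * T.card) + 20 = 8 * Fintype.card (ZMod 2 × ZMod 8) := by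
    rw [show U.card * S.card * T.card = S.card * T.card * U.card by ring]; exact h20
  have h20_UTS : 3 * (U.card * T.card * S.card) + 20 = 8 * Fintype.card (ZMod 2 × ZMod 8) := by
    rw [show U.card * T.card * S.card = S.card * T.card * U.card by ring]; exact h20
  have hmod : Fintype.card (ZMod 2 × ZMod 8) % 3 = 1 := by rw [hA]
  have hA14 : 14 ≤ Fintype.card (ZMod 2 × ZMod 8) := by rw [hA]; norm_num
  have three : ∀ {d e : ℕ}, d * e = 3 → (d = 1 ∧ e = 3) ∨ (d = 3 ∧ e = 1) := by
    intro d e hde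
    have hd : d ∣ 3 := ⟨e, hde.symm⟩
    have hd3 : d ≤ 3 := Nat.le_of_dvd (by norm_num) hd
    interval_cases d <;> omega
  have two12 : ∀ {d e : ℕ}, d + e = 3 → d * e = 2 → (d = 1 ∧ e = 2) ∨ (d = 2 ∧ e = 1) := by
    intro d e h1 h2
    have hd3 : d ≤ 3 := by omega
    interval_cases d <;> omega
  have two24 : ∀ {d e : ℕ}, d + e = 6 → d * e = 8 → (d = 2 ∧ e = 4) ∨ (d = 4 ∧ e = 2) := by
    intro d e h1 h2
    have hd6 : d ≤ 6 := by omega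
    interval_cases d <;> omega
  -- shape d, all orientations, for an arbitrary TPP triple `(X, Y, Z)` in the given roles
  have orientedD : ∀ {X Y Z : Finset G}, TripleProductProperty X Y Z →
      (univ.filter fun a : ZMod 2 × ZMod 8 => ρ a ∈ X).card = 1 →
      (univ.filter fun a : ZMod 2 × ZMod 8 => τ a ∈ X).card = 1 →
      (univ.filter fun a : ZMod 2 × ZMod 8 => ρ a ∈ Y).card + (univ.filter fun a : ZMod 2 × ZMod 8 => τ a ∈ Y).card = 3 →
      (univ.filter fun a : ZMod 2 × ZMod 8 => ρ a ∈ Y).card * (univ.filter fun a : ZMod 2 × ZMod 8 => τ a ∈ Y).card = 2 →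
      (univ.filter fun a : ZMod 2 × ZMod 8 => ρ a ∈ Z).card + (univ.filter fun a : ZMod 2 × ZMod 8 => τ a ∈ Z).card = 6 →
      (univ.filter fun a : ZMod 2 × ZMod 8 => ρ a ∈ Z).card * (univ.filter fun a : ZMod 2 × ZMod 8 => τ a ∈ Z).card = 8 →
      False := by
    intro X Y Z hX hx₀ hx₁ hy hy' hz hz'
    have cρY := card_rho_part_mulRight_tau hρρ hρτ hττ (A := ZMod 2 × ZMod 8) Y
    have cτY := card_tau_part_mulRight_tau hρρ hττ (A := ZMod 2 × ZMod 8) Y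
    have cρZ := card_rho_part_mulRight_tau hρρ hρτ hττ (A := ZMod 2 × ZMod 8) Z
    have cτZ := card_tau_part_mulRight_tau hρρ hττ (A := ZMod 2 × ZMod 8) Z
    rcases two12 hy hy' with ⟨hy₀, hy₁⟩ | ⟨hy₀, hy₁⟩ <;> rcases two24 hz hz' with ⟨hz₀, hz₁⟩ | ⟨hz₀, hz₁⟩
    · exact no_36_shape_d hρρ hρτ hτρ hττ hρ hτ hne hX hx₀ hx₁ hy₀ hy₁ hz₀ hz₁
    · have h' := hX.map_mulRight 1 1 (τ 0)
      simp only [er, Finset.map_refl] at h'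
      exact no_36_shape_d hρρ hρτ hτρ hττ hρ hτ hne h' hx₀ hx₁ hy₀ hy₁ (by rw [cρZ, hz₁]) (by rw [cτZ, hz₀])
    · have h' := hX.map_mulRight 1 (τ 0) 1
      simp only [er, Finset.map_refl] at h'
      exact no_36_shape_d hρρ hρτ hτρ hττ hρ hτ hne h' hx₀ hx₁ (by rw [cρY, hy₁]) (by rw [cτY, hy₀]) hz₀ hz₁
    · have h' := hX.map_mulRight 1 (τ 0) (τ 0)
      simp only [er, Finset.map_refl] at h'
      exact no_36_shape_d hρρ hρτ hτρ hττ hρ hτ hne h' hx₀ hx₁ (by rw [cρY, hy₁]) (by rw [cτY, hy₀])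
        (by rw [cρZ, hz₁]) (by rw [cτZ, hz₀])
  -- shape f, all orientations
  have orientedF : ∀ {X Y Z : Finset G}, TripleProductProperty X Y Z →
      (univ.filter fun a : ZMod 2 × ZMod 8 => ρ a ∈ X).card + (univ.filter fun a : ZMod 2 × ZMod 8 => τ a ∈ X).card = 3 →
      (univ.filter fun a : ZMod 2 × ZMod 8 => ρ a ∈ X).card * (univ.filter fun a : ZMod 2 × ZMod 8 => τ a ∈ X).card = 2 →
      (univ.filter fun a : ZMod 2 × ZMod 8 => ρ a ∈ Y).card + (univ.filter fun a : ZMod 2 × ZMod 8 => τ a ∈ Y).card = 3 →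
      (univ.filter fun a : ZMod 2 × ZMod 8 => ρ a ∈ Y).card * (univ.filter fun a : ZMod 2 × ZMod 8 => τ a ∈ Y).card = 2 →
      (univ.filter fun a : ZMod 2 × ZMod 8 => ρ a ∈ Z).card = 2 →
      (univ.filter fun a : ZMod 2 × ZMod 8 => τ a ∈ Z).card = 2 → False := by
    intro X Y Z hX hx hx' hy hy' hz₀ hz₁
    have cρX := card_rho_part_mulRight_tau hρρ hρτ hττ (A := ZMod 2 × ZMod 8) X
    have cτX := card_tau_part_mulRight_tau hρρ hττ (A := ZMod 2 × ZMod 8) X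
    have cρY := card_rho_part_mulRight_tau hρρ hρτ hττ (A := ZMod 2 × ZMod 8) Y
    have cτY := card_tau_part_mulRight_tau hρρ hττ (A := ZMod 2 × ZMod 8) Y
    rcases two12 hx hx' with ⟨hx₀, hx₁⟩ | ⟨hx₀, hx₁⟩ <;> rcases two12 hy hy' with ⟨hy₀, hy₁⟩ | ⟨hy₀, hy₁⟩
    · exact no_36_shape_f hρρ hρτ hτρ hττ hρ hτ hne hX hx₀ hx₁ hy₀ hy₁ hz₀ hz₁
    · have h' := hX.map_mulRight 1 (τ 0) 1
      simp only [er, Finset.map_refl] at h'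
      exact no_36_shape_f hρρ hρτ hτρ hττ hρ hτ hne h' hx₀ hx₁ (by rw [cρY, hy₁]) (by rw [cτY, hy₀]) hz₀ hz₁
    · have h' := hX.map_mulRight (τ 0) 1 1
      simp only [er, Finset.map_refl] at h'
      exact no_36_shape_f hρρ hρτ hτρ hττ hρ hτ hne h' (by rw [cρX, hx₁]) (by rw [cτX, hx₀]) hy₀ hy₁ hz₀ hz₁
    · have h' := hX.map_mulRight (τ 0) (τ 0) 1
      simp only [er, Finset.map_refl] at h'
      exact no_36_shape_f hρρ hρτ hτρ hττ hρ hτ hne h' (by rw [cρX, hx₁]) (by rw [cτX, hx₀]) (by rw [cρY, hy₁])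
        (by rw [cτY, hy₀]) hz₀ hz₁
  rcases hsh with ⟨a, b, c, d⟩ | ⟨a, b, c, d⟩ | ⟨a, b, c, d⟩ | ⟨et, eu, hp, hδ⟩ | ⟨es, eu, hp, hδ⟩ | ⟨es, et, hp, hδ⟩ |
    ⟨a, b, c, d, e, f⟩ | ⟨a, b, c, d, e, f⟩ | ⟨a, b, c, d, e, f⟩ | ⟨a, b, c, d, e, f⟩ | ⟨a, b, c, d, e, f⟩ |
    ⟨a, b, c, d, e, f⟩ | ⟨a, b, c, d, e, f⟩ | ⟨a, b, c, d, e, f⟩ | ⟨a, b, c, d, e, f⟩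
  -- two dominoes
  · exact hnq (quot_cyclic_of_two_two_sub_four hρρ hρτ hτρ hττ hc₀ hρ hτ hne hsurj hmod hA14 h a b c d h20)
  · exact hnq (quot_cyclic_of_two_two_sub_four hρρ hρτ hτρ hττ hc₀ hρ hτ hne hsurj hmod hA14 (tpp_reverse h.rotate)
      a b c d h20_SUT)
  · exact hnq (quot_cyclic_of_two_two_sub_four hρρ hρτ hτρ hττ hc₀ hρ hτ hne hsurj hmod hA14 h.rotate a b c d h20_TUS)
  -- P3
  · rcases three hp with ⟨hd, he⟩ | ⟨hd, he⟩
    · exact no_sub_four_P3_of_c0_ne_zero hρρ hρτ hτρ hττ hc₀ hρ hτ hne hsurj h hδ hd (by omega) he (by omega) h20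
    · exact no_sub_four_P3_of_c0_ne_zero hρρ hρτ hτρ hττ hc₀ hρ hτ hne hsurj (tpp_reverse h.rotate) hδ he
        (by omega) hd (by omega) h20_SUT
  · rcases three hp with ⟨hd, he⟩ | ⟨hd, he⟩
    · exact no_sub_four_P3_of_c0_ne_zero hρρ hρτ hτρ hττ hc₀ hρ hτ hne hsurj (tpp_reverse h.rotate.rotate) hδ hd
        (by omega) he (by omega) h20_TSU
    · exact no_sub_four_P3_of_c0_ne_zero hρρ hρτ hτρ hττ hc₀ hρ hτ hne hsurj h.rotate hδ he (by omega) hd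
        (by omega) h20_TUS
  · rcases three hp with ⟨hd, he⟩ | ⟨hd, he⟩
    · exact no_sub_four_P3_of_c0_ne_zero hρρ hρτ hτρ hττ hc₀ hρ hτ hne hsurj h.rotate.rotate hδ hd (by omega) he
        (by omega) h20_UST
    · exact no_sub_four_P3_of_c0_ne_zero hρρ hρτ hτρ hττ hc₀ hρ hτ hne hsurj (tpp_reverse h) hδ he (by omega) hd
        (by omega) h20_UTS
  -- shape d in the six role assignments
  · exact orientedD h a b c d e f
  · exact orientedD (tpp_reverse h.rotate) a b c d e f
  · exact orientedD (tpp_reverse h.rotate.rotate) a b c d e f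
  · exact orientedD h.rotate a b c d e f
  · exact orientedD h.rotate.rotate a b c d e f
  · exact orientedD (tpp_reverse h) a b c d e f
  -- shape f in the three role assignments
  · exact orientedF h c d e f a b
  · exact orientedF (tpp_reverse h.rotate) c d e f a b
  · exact orientedF h.rotate c d e f a b

end Law

section C2Q16

/-- **`β(C₂ × Q₁₆) = 32`** (kernel): every TPP triple of `C₂ × Q₁₆ = Multiplicative (ZMod 2) × QuaternionGroup 4` has
`|S||T||U| ≤ 32`, and `32 = 16⌊8/3⌋` is attained. [folklore] -/
theorem c2_quaternion_16_law :
    (∀ S T U : Finset (Multiplicative (ZMod 2) × QuaternionGroup 4), TripleProductProperty S T U →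
        S.card * T.card * U.card ≤ 32) ∧
    ∃ S T U : Finset (Multiplicative (ZMod 2) × QuaternionGroup 4), TripleProductProperty S T U ∧
      S.card * T.card * U.card = 32 := by
  obtain ⟨hwin, S, T, U, h, hV⟩ := c2_quaternion_window_mod_six_four (m := 4) (by norm_num)
  refine ⟨fun S T U h => ?_, S, T, U, h, by rw [hV]⟩
  have h38 := hwin S T U h
  by_contra hgt
  push Not at hgt
  obtain ⟨hc₀, hnq⟩ := z2_z2m_quot_half_noncyclic (m := 4) ⟨2, rfl⟩
  refine c2_quaternion_presentation (m := 4) fun ρ τ c₀ hρρ hρτ hτρ hττ hρ hτ hne' hsurj hc => ?_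
  subst hc
  have hA : Fintype.card (ZMod 2 × ZMod (2 * 4)) = 16 := by rw [Fintype.card_prod, ZMod.card, ZMod.card]
  obtain ⟨h000, h111, h100, h011, h010, h101, h001, h110⟩ := vertex_counting' hρρ hρτ hτρ hττ hρ hτ hne' h
  rw [hA] at h000 h111 h100 h011 h010 h101 h001 h110
  have cS := card_eq_parts' hρ hτ hne' hsurj S
  have cT := card_eq_parts' hρ hτ hne' hsurj T
  have cU := card_eq_parts' hρ hτ hne' hsurj U
  have hV36 : S.card * T.card * U.card = 36 := by
    rw [cS, cT, cU] at hgt h38 ⊢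
    exact (shape36_of_vertex_bounds _ _ _ _ _ _ h000 h111 h100 h011 h010 h101 h001 h110 (by omega) (by omega)).1
  have e4 : ((4 : ℕ) : ZMod (2 * 4)) = (4 : ZMod 8) := rfl
  simp only [e4] at hττ hnq hc₀
  exact no_36_of_c2q16 hρρ hρτ hτρ hττ hρ hτ hne' hsurj hnq h hV36

/-- **`β(C₂ × Q_{4m})` for every `m ≥ 3`** (kernel, all cases in one statement): `(32m − 8)/3` if `m ≡ 1 (mod 6)`,
else `16⌊2m/3⌋` — `c2_quaternion_law_all` (`m ≥ 13`), `c2_quaternion_law` (`m ≢ 1 (mod 3)`),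
`c2_quaternion_law_mod_six_one` (`m = 7`), `c2_quaternion_40_law` (`m = 10`), `c2_quaternion_16_law` (`m = 4`) and the
plain law (`m = 3`). [folklore] -/
theorem c2_quaternion_law_ge_three {m : ℕ} [NeZero m] (hm : 3 ≤ m) :
    (∀ S T U : Finset (Multiplicative (ZMod 2) × QuaternionGroup m), TripleProductProperty S T U →
        S.card * T.card * U.card ≤ if m % 6 = 1 then (32 * m - 8) / 3 else 16 * (2 * m / 3)) ∧
    ∃ S T U : Finset (Multiplicative (ZMod 2) × QuaternionGroup m), TripleProductProperty S T U ∧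
      S.card * T.card * U.card = if m % 6 = 1 then (32 * m - 8) / 3 else 16 * (2 * m / 3) := by
  by_cases h13 : 13 ≤ m
  · exact c2_quaternion_law_all h13
  by_cases h1 : m % 6 = 1
  · simp only [if_pos h1]
    obtain rfl : m = 7 := by omega
    obtain ⟨hub, S, T, U, h, hV⟩ := c2_quaternion_law_mod_six_one (m := 7) rfl le_rfl
    exact ⟨fun S' T' U' h' => by have := hub S' T' U' h'; omega, S, T, U, h, by omega⟩
  simp only [if_neg h1]
  by_cases h3 : m % 3 = 1
  · have hm' : m = 4 ∨ m = 10 := by omega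
    rcases hm' with rfl | rfl
    · obtain ⟨hub, S, T, U, h, hV⟩ := c2_quaternion_16_law
      exact ⟨fun S' T' U' h' => by have := hub S' T' U' h'; omega, S, T, U, h, by omega⟩
    · obtain ⟨hub, S, T, U, h, hV⟩ := c2_quaternion_40_law
      exact ⟨fun S' T' U' h' => by have := hub S' T' U' h'; omega, S, T, U, h, by omega⟩
  by_cases h5 : 5 ≤ m
  · exact c2_quaternion_law h5 h3
  obtain rfl : m = 3 := by omega
  exact ⟨fun S T U h => by have := c2_quaternion_tpp_volume_le_law (m := 3) h; omega,
    c2_quaternion_volume_ge (m := 3) le_rfl⟩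

end C2Q16

end Summit.MatrixMultiplication.OmegaCensus
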